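import Summits.BirchSwinnertonDyer.BirchSwinnertonDyer.Theorems.ClassRecordThreeEulerHalvesAtThreeChebSupplyNonempty
import Summits.BirchSwinnertonDyer.BirchSwinnertonDyer.Theorems.ClassRecordThreeEulerHalvesAtThreeChebSupplyDensity
import Summits.BirchSwinnertonDyer.BirchSwinnertonDyer.Theorems.ClassRecordThreeEulerHalvesAtThreeChebSupplyFrobenius
import Summits.BirchSwinnertonDyer.BirchSwinnertonDyer.Theorems.ClassRecordThreeEulerHalvesAtThreeChebSupplyGlue
import Literature.NumberTheory.EllipticCurves.Rank1Residual.Predicates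
import Literature.NumberTheory.EllipticCurves.RingClassFieldTower
import Literature.NumberTheory.ComplexMultiplication.CMLatticeRingClassTowerRamified
import Mathlib.RingTheory.RootsOfUnity.Minpoly
import Mathlib.RingTheory.Polynomial.Cyclotomic.Roots
import HarnessLib

/-!
# `stub_chebotarevSupplyAtThree` — the Chebotarev supply of line `inert` (crux 19109) PROVED

Crux `stmt-BirchSwinnertonDyer-19109` (`EulerHalvesAtThree`), line `inert` (tam3-p1 g18, skeleton r19,
registered sha16 `da97b7f57ae6d1ae`).  This file proves the registered stub `stub_chebotarevSupplyAtThree`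
(signature verbatim) by assembling the parts landed in `…ChebSupplyGL2` (p649893), `…ChebSupplyRoots`
(p650478), `…ChebSupplyKummerGenerator` (p651463), `…ChebSupplyOrder` (p651865), `…ChebSupplyNonempty`
(p652012), `…ChebSupplyFrobenius` (p652633), `…ChebSupplyDensity` (p653032) and the quadratic-field
glue `…ChebSupplyGlue`:

* `stub_chebotarevSupplyAtThree` — **the stub** (docstring there).

With it, `stub_auxiliaryInertLevelAtThree` of the skeleton is closed as well
(`AuxInertLevel.stub_auxiliaryInertLevelAtThree_of_chebotarevSupply`, p648431).  HONEST FRAMING: this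
closes ONE registered stub (and the one derived from it) of ONE line of crux 19109; the line's remaining
obligations (three citable bundles, the IMC-grade residual stub, `stub_x11aLowerHalfAtThree` = 19064@3,
and the olean of the proved `stub_carrierLocalE0AtThree`) are untouched, and nothing about BSD for any
curve is proved here.

## References

* J.-P. Serre, *Propriétés galoisiennes des points d'ordre fini des courbes elliptiques*, Invent. Math. 15
  (1972), §2, §4. [Serre1972]
* B. H. Gross, *Kolyvagin's work on modular elliptic curves* in *L-functions and Arithmetic*, LMS Lecture Notes 153 (1991), §3 (the Chebotarev primes). [GrossLMS1991]
* J. Neukirch, *Algebraic Number Theory* (1999), Ch. I §9, Ch. VII §13. [NeukirchANT1999]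

## Mathlib / tree search

Tree: `card_units_eq_two_of_discr_lt` (`RingClassFieldTower`),
`CMTypeLattice.units_eq_one_or_neg_one_of_natCard_eq_two`, `absEmbedding_absGaloisQuot_apply`,
`absGaloisQuot_eq_one_iff`, `coe_absEmbeddingInt`, `HeightOneSpectrum.isMaximal_of_mem_primesAbove`,
`ChebSupply.*` (the seven files above).  Mathlib: `Ideal.exists_smul_eq_of_isGaloisGroup`,
`IsGaloisGroup.of_isFractionRing`, `FractionalIdeal.count_mul/_pow/_self/_maximal_coprime`,
`Nat.findGreatest_spec`, `Nat.le_findGreatest`, `IsFractionRing.div_surjective`,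
`Polynomial.isRoot_cyclotomic_iff`, `IsAlgClosed.exists_root`, `IsAlgClosed.exists_pow_nat_eq`,
`IsPrimitiveRoot.isIntegral`, `IsIntegral.of_pow`, `IsIntegral.tower_top`, `IsUnit.of_pow_eq_one`.
-/

noncomputable section

set_option autoImplicit false
set_option linter.dupNamespace false

open scoped NumberField Pointwise nonZeroDivisors
open Field IsDedekindDomain NumberField
open Literature.NumberTheory.GaloisRepresentations Literature.NumberTheory.EllipticCurves

namespace Summit.BirchSwinnertonDyer.BirchSwinnertonDyer.Theorems.ChebSupply

/-- **`stub_chebotarevSupplyAtThree` — the CHEBOTAREV SUPPLY of line `inert` (crux 19109), registered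
signature verbatim.**  For `E/ℚ` in global minimal form with `Surj W 3`, `K` imaginary quadratic with
`d_K < -4`, a rational prime `q` split in `K`, `v ∣ q`, and a generator `β` of `v^A · (t)` (`A, t > 0`):
for every finite set `S` of primes and every `e` there is a prime `ℓ ∉ S`, INERT in `K`, with
`3 ∤ a_ℓ(E)`, such that every `d` with `β^d ≡ a (mod ℓ𝓞_K)` for some `a ∈ ℤ` is divisible by `3^e`.

Proof (STUB-PLAN, evidence #57 on the item; all parts landed in `…ChebSupply*`):
GLUE — `τ` the non-trivial automorphism, `τv ≠ v` (`smul_asIdeal_ne_of_ncard_eq_two`); `k` maximal with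
`β/τβ = γ₀^{3^k}` in `K^×` (`Nat.findGreatest`, bounded by `pow_dvd_of_smul_rel`), so `γ₀ = γ₁/γ₂` is not
a cube, `τγ₀ = γ₀⁻¹` (`eq_one_of_pow_eq_one_of_odd`), `g = γ₁γ₂²`, `β γ₂^{3^{k+1}} = (τβ) g^{3^k}`;
roots `ζ` (order `3^{e+k}`), `ω`, and `c³ = ι γ₀` in `ℚ̄`.  NON-EMPTINESS (`exists_frobeniusClass_elt`,
p652012): `σ₀ ∉ Gal(ℚ̄/K)` with `σ₀ζ = ζ⁻¹`, `σ₀ω = ω⁻¹`, `tr ρ̄_{E,3}(σ₀) ≠ 0`, `σ₀²c ≠ c` — whence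
`σ₀² C = θ C` for the algebraic integer `C = c·ιγ₂` (`C³ = ι g`) and a cube root of unity `θ ≠ 1`.
DENSITY (`exists_isArithFrobAt_near`, p653032): an arithmetic Frobenius `σ` at `𝔓 ∣ ℓ` agreeing with
`σ₀` on `ζ, C, σ₀C`, on `K` and on `E[3]`, with `ℓ ∉ S` inert, `3 ∤ a_ℓ`, `β, γ₂, g ∉ 𝔓`.  DICTIONARY
(`three_pow_dvd_of_isArithFrobAt`, p652633): the order condition.  Uses the tree's discharged
Chebotarev density for Artin representations (`chebotarev_artinRep_holds`) and Serre's (238)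
(`trace_galoisRepTorsion_frobenius_eq`); no `ρ_{E,9}`, no structure of `Gal(ℚ(E[3])/ℚ)` beyond `Surj`.
[cite: Serre1972, §2, §4] [cite: NeukirchANT1999, Ch. VII §13] [cite: GrossLMS1991, §3] -/
theorem stub_chebotarevSupplyAtThree :
    ∀ (W : WeierstrassCurve ℚ) [W.IsElliptic] [W.IsGloballyMinimal] (K : Type) [Field K]
      [NumberField K], IsImaginaryQuadratic K → NumberField.discr K < -4 →
      Literature.NumberTheory.EllipticCurves.Rank1Residual.Surj W 3 →
      ∀ (q : ℕ), q.Prime → ((Ideal.span {(q : ℤ)}).primesOver (𝓞 K)).ncard = 2 →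
      ∀ (v : HeightOneSpectrum (𝓞 K)), (q : 𝓞 K) ∈ v.asIdeal →
      ∀ (A : ℕ), 0 < A → ∀ (t : ℤ), 0 < t → ∀ (β : 𝓞 K),
        v.asIdeal ^ A * Ideal.span {(t : 𝓞 K)} = Ideal.span {β} →
      ∀ (S : Finset ℕ) (e : ℕ), ∃ ℓ : ℕ, ℓ.Prime ∧ ℓ ∉ S ∧ (Ideal.span {(ℓ : 𝓞 K)}).IsPrime ∧
        ¬ (3 : ℤ) ∣ W.frobeniusTrace ℓ ∧
        ∀ d : ℕ, (∃ a : ℤ, β ^ d - (a : 𝓞 K) ∈ Ideal.span {(ℓ : 𝓞 K)}) → 3 ^ e ∣ d := by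
  intro W _ _ K _ _ hK hD hsurj q hq hq2 v hqv A hA t ht β hβ S e
  classical
  have h2 : Module.finrank ℚ K = 2 := hK.1
  haveI : Algebra.IsQuadraticExtension ℚ K := ⟨h2⟩
  have hKc : IsTotallyComplex K := hK.2
  have hunits : Nat.card (𝓞 K)ˣ = 2 := card_units_eq_two_of_discr_lt hK hD
  set ι := absEmbedding ℚ K with hιdef
  -- ### the automorphism `τ` and the conjugate prime
  obtain ⟨τ, hτ1, hall⟩ := exists_aut_ne_one h2
  have hττ : τ * τ = 1 := by
    rcases hall (τ * τ) with h | h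
    · exact h
    · exact absurd (mul_left_cancel (h.trans (mul_one τ).symm)) hτ1
  have hτv : τ • v.asIdeal ≠ v.asIdeal := smul_asIdeal_ne_of_ncard_eq_two h2 hτ1 hall hq hq2 hqv
  have ht0 : t ≠ 0 := ht.ne'
  have hβ0 : β ≠ 0 := by
    intro h0
    have hI0 : v.asIdeal ^ A * Ideal.span {(t : 𝓞 K)} ≠ ⊥ :=
      mul_ne_zero (pow_ne_zero A v.ne_bot)
        (by rw [Ne, Ideal.zero_eq_bot, Ideal.span_singleton_eq_bot]; exact_mod_cast ht0)
    apply hI0; rw [hβ, h0, Ideal.span_singleton_eq_bot]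
  have hτβ0 : τ • β ≠ 0 := (smul_ne_zero_iff_ne τ).mpr hβ0
  -- ### the Kummer datum: `k` maximal with `β/τβ ∈ (K^×)^{3^k}`
  let P : ℕ → Prop := fun j => ∃ γ₁ γ₂ : 𝓞 K, γ₂ ≠ 0 ∧ β * γ₂ ^ 3 ^ j = (τ • β) * γ₁ ^ 3 ^ j
  have hP0 : P 0 := ⟨β, τ • β, hτβ0, by ring⟩
  have hPb : ∀ j, P j → j ≤ A := fun j ⟨γ₁, γ₂, hγ₂, hrel⟩ =>
    ((Nat.lt_pow_self (by norm_num : 1 < 3)).le).trans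
      (Nat.le_of_dvd hA (pow_dvd_of_smul_rel hτv ht0 hβ hγ₂ hrel))
  set k := Nat.findGreatest P A with hkdef
  have hPk : P k := Nat.findGreatest_spec (Nat.zero_le A) hP0
  have hnot : ¬ P (k + 1) := fun h => by
    have := Nat.le_findGreatest (hPb _ h) h
    omega
  obtain ⟨γ₁, γ₂, hγ₂0, hrelk⟩ := hPk
  have hγ₁0 : γ₁ ≠ 0 := by
    intro h0
    rw [h0, zero_pow (pow_ne_zero k (by norm_num)), mul_zero] at hrelk
    exact (mul_ne_zero hβ0 (pow_ne_zero _ hγ₂0)) hrelk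
  set g : 𝓞 K := γ₁ * γ₂ ^ 2 with hgdef
  have hg0 : g ≠ 0 := mul_ne_zero hγ₁0 (pow_ne_zero 2 hγ₂0)
  have hrel : β * γ₂ ^ 3 ^ (k + 1) = (τ • β) * g ^ 3 ^ k := by
    calc β * γ₂ ^ 3 ^ (k + 1) = (β * γ₂ ^ 3 ^ k) * (γ₂ ^ 2) ^ 3 ^ k := by ring
      _ = ((τ • β) * γ₁ ^ 3 ^ k) * (γ₂ ^ 2) ^ 3 ^ k := by rw [hrelk]
      _ = (τ • β) * g ^ 3 ^ k := by rw [hgdef]; ring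
  -- `γ₀ = γ₁/γ₂` is not a cube
  set γ₀ : K := (γ₁ : K) / (γ₂ : K) with hγ₀def
  have hγ₂K : (γ₂ : K) ≠ 0 := by exact_mod_cast hγ₂0
  have hγ₁K : (γ₁ : K) ≠ 0 := by exact_mod_cast hγ₁0
  have hγ₀0 : γ₀ ≠ 0 := div_ne_zero hγ₁K hγ₂K
  have hγ₀ : ∀ z : K, z ^ 3 ≠ γ₀ := by
    intro z hz
    obtain ⟨z₁, z₂, hz₂, rfl⟩ := IsFractionRing.div_surjective (A := 𝓞 K) z
    have hz₂0 : z₂ ≠ 0 := nonZeroDivisors.ne_zero hz₂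
    have hz₂K : (z₂ : K) ≠ 0 := by exact_mod_cast hz₂0
    -- `γ₁ z₂³ = γ₂ z₁³`
    have h1 : γ₁ * z₂ ^ 3 = γ₂ * z₁ ^ 3 := by
      have h := hz
      rw [hγ₀def, div_pow, div_eq_div_iff (pow_ne_zero 3 hz₂K) hγ₂K] at h
      apply Subtype.ext
      change ((γ₁ * z₂ ^ 3 : 𝓞 K) : K) = ((γ₂ * z₁ ^ 3 : 𝓞 K) : K)
      push_cast
      change (algebraMap (𝓞 K) K z₁) ^ 3 * (γ₂ : K) = γ₁ * (algebraMap (𝓞 K) K z₂) ^ 3 at h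
      rw [show (algebraMap (𝓞 K) K z₁) = (z₁ : K) from rfl,
        show (algebraMap (𝓞 K) K z₂) = (z₂ : K) from rfl] at h
      linear_combination -h
    apply hnot
    refine ⟨z₁, z₂, hz₂0, ?_⟩
    have h3 : β * γ₂ ^ 3 ^ k * z₂ ^ 3 ^ (k + 1) = (τ • β) * γ₂ ^ 3 ^ k * z₁ ^ 3 ^ (k + 1) := by
      calc β * γ₂ ^ 3 ^ k * z₂ ^ 3 ^ (k + 1)
          = ((τ • β) * γ₁ ^ 3 ^ k) * z₂ ^ 3 ^ (k + 1) := by rw [hrelk]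
        _ = (τ • β) * (γ₁ * z₂ ^ 3) ^ 3 ^ k := by ring
        _ = (τ • β) * (γ₂ * z₁ ^ 3) ^ 3 ^ k := by rw [h1]
        _ = (τ • β) * γ₂ ^ 3 ^ k * z₁ ^ 3 ^ (k + 1) := by ring
    have h4 := mul_right_cancel₀ (pow_ne_zero (3 ^ k) hγ₂0)
      (show β * z₂ ^ 3 ^ (k + 1) * γ₂ ^ 3 ^ k = (τ • β) * z₁ ^ 3 ^ (k + 1) * γ₂ ^ 3 ^ k by
        linear_combination h3)
    exact h4
  -- `τ γ₀ = γ₀⁻¹`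
  have hrelK : (β : K) * (γ₂ : K) ^ 3 ^ k = τ (β : K) * (γ₁ : K) ^ 3 ^ k := by
    have h := congrArg (fun z : 𝓞 K => (z : K)) hrelk
    push_cast at h; rw [AlgEquiv.smul_def] at h; exact h
  have hβK : (β : K) ≠ 0 := by exact_mod_cast hβ0
  have hτβK : τ (β : K) ≠ 0 := (map_ne_zero_iff τ τ.injective).mpr hβK
  have hττK : ∀ x : K, τ (τ x) = x := fun x => by
    rw [← AlgEquiv.mul_apply, hττ, AlgEquiv.one_apply]
  have hτγ₀ : τ γ₀ = γ₀⁻¹ := by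
    -- `u = γ₀ · τγ₀` satisfies `u^{3^k} = 1`
    have hrelK' := congrArg τ hrelK
    rw [map_mul, map_mul, map_pow, map_pow, hττK] at hrelK'
    have hτγ₂K : τ (γ₂ : K) ≠ 0 := (map_ne_zero_iff τ τ.injective).mpr hγ₂K
    have e3 : ((γ₁ : K) * τ (γ₁ : K)) ^ 3 ^ k = ((γ₂ : K) * τ (γ₂ : K)) ^ 3 ^ k := by
      refine mul_right_cancel₀ (mul_ne_zero hβK hτβK) ?_
      linear_combination (-(τ (γ₁ : K)) ^ 3 ^ k * (β : K)) * hrelK +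
        (-(γ₂ : K) ^ 3 ^ k * (β : K)) * hrelK'
    have hu : (γ₀ * τ γ₀) ^ 3 ^ k = 1 := by
      rw [hγ₀def, map_div₀, div_mul_div_comm, div_pow, e3,
        div_self (pow_ne_zero _ (mul_ne_zero hγ₂K hτγ₂K))]
    have hodd : Odd (3 ^ k) := Odd.pow (by decide)
    exact eq_inv_of_mul_eq_one_right (eq_one_of_pow_eq_one_of_odd hunits hodd hu)
  have hτ' : ∀ τ' : K ≃ₐ[ℚ] K, τ' ≠ 1 → τ' γ₀ = γ₀⁻¹ := by
    intro τ' hτ'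
    rcases hall τ' with h | h
    · exact absurd h hτ'
    · rw [h]; exact hτγ₀
  -- ### roots of unity and the cube root in `ℚ̄`
  have hroot : ∀ n : ℕ, 0 < n → ∃ μ : AlgebraicClosure ℚ, IsPrimitiveRoot μ n := by
    intro n hn
    haveI : NeZero (n : AlgebraicClosure ℚ) := ⟨by exact_mod_cast hn.ne'⟩
    obtain ⟨μ, hμ⟩ := IsAlgClosed.exists_root (Polynomial.cyclotomic n (AlgebraicClosure ℚ))
      (Polynomial.degree_cyclotomic_pos n _ hn).ne'
    exact ⟨μ, (Polynomial.isRoot_cyclotomic_iff).mp hμ⟩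
  have hEpos : 0 < 3 ^ (e + k) := pow_pos (by norm_num) _
  obtain ⟨ζ, hζ⟩ := hroot (3 ^ (e + k)) hEpos
  obtain ⟨ω, hω⟩ := hroot 3 (by norm_num)
  obtain ⟨c, hc⟩ := IsAlgClosed.exists_pow_nat_eq (ι γ₀) (by norm_num : 0 < 3)
  -- ### NON-EMPTINESS: the element `σ₀`
  obtain ⟨σ₀, hσ₀r, hσζ, hσω, htr, hσc⟩ :=
    exists_frobeniusClass_elt W hsurj h2 hKc hunits hγ₀ hτ' hω hζ hEpos hc
  -- `σ₀` acts on `K` through `τ`, and `σ₀²` trivially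
  have hq₀ : absGaloisQuot ℚ K σ₀ = τ := by
    rcases hall (absGaloisQuot ℚ K σ₀) with h | h
    · exact absurd ((absGaloisQuot_eq_one_iff ℚ K σ₀).mp h) hσ₀r
    · exact h
  have hσ₀K : ∀ x : K, σ₀ • (σ₀ • ι x) = ι x := fun x => by
    rw [hιdef, ← absEmbedding_absGaloisQuot_apply, ← absEmbedding_absGaloisQuot_apply, hq₀, hττK]
  -- ### integral lifts: `ζ`, `C = c · ι γ₂` (`C³ = ι g`), `θ = ω^i`
  have hC3 : (c * ι (γ₂ : K)) ^ 3 = ι (g : K) := by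
    rw [mul_pow, hc, ← map_pow, ← map_mul, hγ₀def, hgdef]
    congr 1
    push_cast
    field_simp
  have hint_of : ∀ x : AlgebraicClosure ℚ, IsIntegral ℤ x → x ∈ absIntegers (𝓞 ℚ) ℚ := fun x hx =>
    show IsIntegral (𝓞 ℚ) x from hx.tower_top
  have hζint : ζ ∈ absIntegers (𝓞 ℚ) ℚ := hint_of ζ (hζ.isIntegral hEpos)
  have hωint : ω ∈ absIntegers (𝓞 ℚ) ℚ := hint_of ω (hω.isIntegral (by norm_num))
  have hCint : c * ι (γ₂ : K) ∈ absIntegers (𝓞 ℚ) ℚ := by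
    refine hint_of _ (IsIntegral.of_pow (by norm_num : 0 < 3) ?_)
    rw [hC3]
    exact (g.isIntegral_coe).map ι
  set ζA : absIntegers (𝓞 ℚ) ℚ := ⟨ζ, hζint⟩ with hζAdef
  set ωA : absIntegers (𝓞 ℚ) ℚ := ⟨ω, hωint⟩ with hωAdef
  set CA : absIntegers (𝓞 ℚ) ℚ := ⟨c * ι (γ₂ : K), hCint⟩ with hCAdef
  have hCA3 : CA ^ 3 = absEmbeddingInt ℚ K g := by
    apply Subtype.ext
    rw [Subalgebra.coe_pow, coe_absEmbeddingInt]
    exact hC3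
  -- `σ₀² c = ω^i c` with `i ∈ {1, 2}`
  have hc0 : c ≠ 0 := by
    intro h; rw [h, zero_pow three_ne_zero] at hc
    exact (map_ne_zero_iff ι ι.toRingHom.injective).mpr hγ₀0 hc.symm
  have hσσc3 : (σ₀ • (σ₀ • c)) ^ 3 = c ^ 3 := by
    rw [← smul_pow', ← smul_pow', hc, hσ₀K]
  obtain ⟨i, hi3, hi⟩ := eq_mul_pow_of_pow_three_eq hω hc0 hσσc3
  have hi0 : ω ^ i ≠ 1 := by
    intro h1; apply hσc; rw [hi, h1, one_mul]
  set θA : absIntegers (𝓞 ℚ) ℚ := ωA ^ i with hθAdef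
  have hθ3 : θA ^ 3 = 1 := by
    apply Subtype.ext
    rw [hθAdef, ← pow_mul, Subalgebra.coe_pow, Subalgebra.coe_one]
    change ω ^ (i * 3) = 1
    rw [mul_comm, pow_mul, hω.pow_eq_one, one_pow]
  have hθ1 : θA ≠ 1 := by
    intro h1; apply hi0
    have := congrArg (fun z : absIntegers (𝓞 ℚ) ℚ => (z : AlgebraicClosure ℚ)) h1
    simpa [hθAdef, hωAdef, Subalgebra.coe_pow] using this
  have hσCA : σ₀ • (σ₀ • CA) = θA * CA := by
    apply Subtype.ext
    rw [integralClosure.coe_smul, integralClosure.coe_smul, Subalgebra.coe_mul, hθAdef,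
      Subalgebra.coe_pow]
    change σ₀ • (σ₀ • (c * ι (γ₂ : K))) = ω ^ i * (c * ι (γ₂ : K))
    rw [smul_mul', smul_mul', hi, hσ₀K, mul_assoc]
  -- ### DENSITY: a Frobenius `σ` near `σ₀`
  have hY : ∀ y ∈ ({β, γ₂, g} : Finset (𝓞 K)), y ≠ 0 := by
    intro y hy
    simp only [Finset.mem_insert, Finset.mem_singleton] at hy
    rcases hy with rfl | rfl | rfl
    · exact hβ0
    · exact hγ₂0
    · exact hg0
  obtain ⟨σ, w, 𝔓, ℓ, hσB, hquot, h𝔓, hfrob, hℓ, hℓS, hℓ3, hq𝔓, hℓ𝔓, hinert, haℓ, hnorm⟩ :=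
    exists_isArithFrobAt_near W hσ₀r htr ({ζA, CA, σ₀ • CA} : Finset (absIntegers (𝓞 ℚ) ℚ)) S
      ({β, γ₂, g} : Finset (𝓞 K)) hY
  haveI : 𝔓.IsMaximal := HeightOneSpectrum.isMaximal_of_mem_primesAbove h𝔓
  -- `σ` on `ζ`, on `C`
  have hσζA : σ • ζA = σ₀ • ζA := hσB ζA (by simp)
  have hσCA1 : σ • CA = σ₀ • CA := hσB CA (by simp)
  have hσCA2 : σ • (σ₀ • CA) = σ₀ • (σ₀ • CA) := hσB (σ₀ • CA) (by simp)
  have hσζ' : σ • (ζA : AlgebraicClosure ℚ) = (ζA : AlgebraicClosure ℚ)⁻¹ := by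
    rw [← integralClosure.coe_smul, hσζA, integralClosure.coe_smul]
    exact hσζ
  have hσC' : σ • (σ • CA) = θA * CA := by rw [hσCA1, hσCA2, hσCA]
  have hrelq : β * γ₂ ^ 3 ^ (k + 1) = (absGaloisQuot ℚ K σ₀ • β) * g ^ 3 ^ k := by
    rw [hq₀]; exact hrel
  have hζA : IsPrimitiveRoot (ζA : AlgebraicClosure ℚ) (3 ^ (e + k)) := hζ
  refine ⟨ℓ, hℓ, hℓS, hinert, haℓ, fun d ⟨a, ha⟩ => ?_⟩
  exact three_pow_dvd_of_isArithFrobAt hfrob hℓ hq𝔓 hℓ𝔓 hℓ3 hquot hζA hσζ' hθ3 hθ1 hσC' hCA3 hrelq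
    (hnorm β (by simp)) (hnorm γ₂ (by simp)) (hnorm g (by simp)) ha

end Summit.BirchSwinnertonDyer.BirchSwinnertonDyer.Theorems.ChebSupply

end
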